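/-
Copyright (c) 2026 the pub-hodgecm-mathlib formalisation cell (harness21).  Prover seat hodgecm-mathlib-F0P2-p10 (g3), Track B «K2-LIT»,
#184♮ = hLiu418 = `stmt-HodgeConjecture-24832`; FACE-D₀ (B1c′) chain of K2Liu-p02 (g9), FILE 2 rider (the `hS0` letter of ★ p863770 ∕ 📤 p863896).
THEOREMS ONLY (no `def`, no `instance`, no notation, no named-fact hypothesis, no `sorry`).
-/
import Summits.HodgeConjecture.HodgeConjecture.Theorems.K2LiuLinePairCayleySiegelUnipotent   -- ★ FILE 2c: `aMat_cMat_lineKappa_of_mem_unipDelta` (the explicit `c_q`)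
import Literature.NumberTheory.Automorphic.AdelicMatrixPoisson                                 -- ★ `archHom`
import HarnessLib

/-!
# Crux `HLiu418`, FACE-D₀ (B1c′), FILE 2 rider — `K2LiuLinePairCayleySiegelArchZero`: `c_q` OF THE UNIPOTENT BLOCK HAS ZERO ARCHIMEDEAN PART
# when the block coordinate `X_u = (blk u)₁₂` of `u ∈ N_Δ(𝔸)` has zero archimedean part (the letter `hS0` of ★ `K2LiuLinePairKappaModelOnUnipotents`)

Cell `hodgecm-mathlib`, crux item hLiu418 = `stmt-HodgeConjecture-24832` (helper lane `--supports … --as helper`, count-neutral), route of record `HCCMUnconditional`;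
squad K2 ∕ K2Liu, road `K2_Liu`, socket #42F′ FACE-D₀ `h2₂`, chain (B1c′): ★ p863642 FILE 1, ★ p863784∕p863828∕p863869 FILE 2a∕2b∕2c (this seat), ★ p863770 FILE 3 +
📤 p863896 `K2LiuLinePairKappaModelLetter` (K2Liu-p02), `K2LiuLinePairSeamAdapters` (K2Liu-p09).

WHY.  FILE 3's κ-model on a pure tensor takes BY VALUE `hS : (−⅟2) • c_q = S` and `hS0 : S.map (archHom L⁺) = 0` (`q = q_u := ratSp κ′ · j(u) · (ratSp κ′)⁻¹`,
`u ∈ N_Δ(𝔸)` a FINITE-adelic unipotent, i.e. `X_u` has zero archimedean part, as the theta-side `ι z` of FACE-D₀ are).  ★ FILE 2c reads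
`c_q = 1ᵀ · ρ∕σ-re-enumeration of (a′ ⊗ 1) • (J₂ · Res(−X_u − X_u) · D₂⁻¹)`, and EVERY block of `Res(Y) = (re Y, d • im Y T₀⁻¹; T₀ im Y, T₀ re Y T₀⁻¹)` carries a factor `re Y` or
`im Y`; the quadratic coordinates `re`, `im` of `𝔸_L = 𝔸_{L⁺} ⊕ 𝔸_{L⁺} δ` are computed PLACE-BLOCK by place-block (★ `quadraticAdeleEquiv_symm_fst`: the archimedean part of
`Ψ_𝔸⁻¹ y` is `Ψ_∞⁻¹ y_∞`), so `Y_∞ = 0 ⇒ (re Y)_∞ = (im Y)_∞ = 0`, and a ring homomorphism that kills `re Y`, `im Y` kills `c_q`.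
* §1 `fst_re_im_eq_zero` (an adele of `L` with zero archimedean part has quadratic coordinates with zero archimedean parts); the matrix forms
  `map_re_map_archHom_eq_zero`, `map_im_map_archHom_eq_zero`; the spelling bridge `neg_sub_self_eq_neg_two_smul` (`−X − X = −(2 • X)`);
* §2 **`cMat_lineKappa_map_archHom_eq_zero_of_mem_unipDelta`** — `u ∈ N_Δ(𝔸)`, `X_u.map adeleFst = 0` (★ `K2LiuUnipotentChartLocal`'s `hfst` spelling) ⟹
  `(SiegelParabolicPi.cMat q_u).map (archHom L⁺) = 0`; and the `S`-form **`hS0_lineKappa_of_mem_unipDelta`**: `((−⅟2) • SiegelParabolicPi.cMat q_u).map (archHom L⁺) = 0`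
  (= FILE 3's `hS0` at `S := (−⅟2) • c_q`, `hS := rfl`).
[Kudla1994, §3] [Weil1964, Chap. I n° 13 p. 160, Chap. III n° 46 p. 202] [CasselsFrohlichANT1967, Ch. II §14].
HONEST LABEL.  Count-neutral helper, closes no socket by itself: `HC_CM` is proved only modulo the 7 printed citations (2 remaining named inputs: hLiu418 =
`stmt-HodgeConjecture-24832`, h413 = `stmt-HodgeConjecture-24833`) until rung 0 closes; FACE-D₀ `h2₂` is NOT discharged by this file.

## References
* [Kudla1994] S. S. Kudla, Israel J. Math. 87 (1994): §3.   * [Weil1964] A. Weil, Acta Math. 111 (1964): Chap. I n° 13, Chap. III n° 46.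
* [CasselsFrohlichANT1967] J. W. S. Cassels, A. Fröhlich (eds.), *Algebraic Number Theory* (1967): Ch. II §14 (adeles of an extension).
-/

set_option autoImplicit false
-- the mandated namespace repeats the single-problem summit's segment (`HodgeConjecture.HodgeConjecture`)
set_option linter.dupNamespace false

noncomputable section

open scoped Matrix Kronecker
open NumberField IsDedekindDomain

namespace Summit.HodgeConjecture.HodgeConjecture.Cruxes.HLiu418.K2LiuLinePairCayleySiegelArchZero

open Literature.NumberTheory.Automorphic Literature.NumberTheory.Automorphic.UnitaryGroup
open Literature.NumberTheory.Automorphic.UnitaryGroup.QuadraticCoordinates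
open Literature.NumberTheory.Automorphic.UnitaryGroup.SpTransport
open Literature.RepresentationTheory.HeisenbergGroup Literature.RepresentationTheory.HeisenbergGroup.SymplecticMatrix
open Literature.NumberTheory.GelbartRogawski1991 Literature.NumberTheory.GelbartRogawski1991.GRConstruction
open Literature.NumberTheory.GelbartRogawski1991.UnitaryDualPair
open Literature.NumberTheory.Weil1964
open Literature.NumberTheory.Automorphic.Liu2021 Literature.NumberTheory.Automorphic.Liu2021.Def411WeilCarriers
open Literature.NumberTheory.K2Lit.DoubledLineTheta Literature.NumberTheory.K2Lit.SiegelDoubled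
open Summit.HodgeConjecture.HodgeConjecture.Cruxes.HLiu418.K2LiuLinePairCayleySiegel
open Summit.HodgeConjecture.HodgeConjecture.Cruxes.HLiu418.K2LiuLinePairCayleySiegelUnipotent

/-! ## §1 Quadratic coordinates of an adele with zero archimedean part -/

section Coordinates

variable (L : Type) [Field L] [NumberField L] [IsCMField L]

/-- **`y_∞ = 0 ⇒ (re y)_∞ = 0 ∧ (im y)_∞ = 0`**: the archimedean part of `Ψ_𝔸⁻¹ y` is `Ψ_∞⁻¹ y_∞` (★ `quadraticAdeleEquiv_symm_fst`), and `re y = (Ψ_𝔸⁻¹ y).1`,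
`im y = (Ψ_𝔸⁻¹ y).2` (★ `re_def`, `im_def`). [cite: CasselsFrohlichANT1967, Ch. II §14] -/
theorem fst_re_im_eq_zero (y : AdeleRing (𝓞 L) L) (hy : y.1 = 0) :
    ((re (quadraticAdeleEquiv (Fp L) L (IsCMField.complexConj L) (complexConj_imagUnit L) (imagUnit_ne_zero L)).toAddEquiv) y).1 = 0 ∧ ((im (quadraticAdeleEquiv (Fp L) L (IsCMField.complexConj L) (complexConj_imagUnit L) (imagUnit_ne_zero L)).toAddEquiv) y).1 = 0 := by
  have h := quadraticAdeleEquiv_symm_fst (F := Fp L) (E := L) (IsCMField.complexConj L) (complexConj_imagUnit L) (imagUnit_ne_zero L) y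
  rw [hy, map_zero, Prod.mk_eq_zero] at h
  exact h

/-- **matrix form, `re`**: `Y.map adeleFst = 0 ⇒ ((Y.map re).map f) = 0` for every map `f` factoring through the archimedean part (here `archHom L⁺ = ι_∞ ∘ fst`).
[cite: CasselsFrohlichANT1967, Ch. II §14] -/
theorem map_re_map_archHom_eq_zero {ι κ : Type*} (Y : Matrix ι κ (AdeleRing (𝓞 L) L)) (hY : Y.map (UnitaryGroup.adeleFst L) = 0) :
    (Y.map (re (quadraticAdeleEquiv (Fp L) L (IsCMField.complexConj L) (complexConj_imagUnit L) (imagUnit_ne_zero L)).toAddEquiv)).map (archHom (Fp L)) = 0 := by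
  refine Matrix.ext fun i j => ?_
  have hij : (Y i j).1 = 0 := by
    have h := congrFun (congrFun hY i) j
    exact h
  rw [Matrix.map_apply, Matrix.map_apply, archHom_apply, (fst_re_im_eq_zero L (Y i j) hij).1, map_zero, Matrix.zero_apply]

/-- **matrix form, `im`**. [cite: CasselsFrohlichANT1967, Ch. II §14] -/
theorem map_im_map_archHom_eq_zero {ι κ : Type*} (Y : Matrix ι κ (AdeleRing (𝓞 L) L)) (hY : Y.map (UnitaryGroup.adeleFst L) = 0) :
    (Y.map (im (quadraticAdeleEquiv (Fp L) L (IsCMField.complexConj L) (complexConj_imagUnit L) (imagUnit_ne_zero L)).toAddEquiv)).map (archHom (Fp L)) = 0 := by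
  refine Matrix.ext fun i j => ?_
  have hij : (Y i j).1 = 0 := by
    have h := congrFun (congrFun hY i) j
    exact h
  rw [Matrix.map_apply, Matrix.map_apply, archHom_apply, (fst_re_im_eq_zero L (Y i j) hij).2, map_zero, Matrix.zero_apply]

/-- `reindex` commutes with entrywise maps. [folklore] -/
theorem reindex_map_eq {α β : Type*} {ι κ ι' κ' : Type*} (eι : ι ≃ ι') (eκ : κ ≃ κ') (M : Matrix ι κ α) (f : α → β) :
    (Matrix.reindex eι eκ M).map f = Matrix.reindex eι eκ (M.map f) := rfl

/-- the `N_Δ`-frame spelling bridge `−X − X = −(2 • X)` (FILE 2c's `b₂₁ − b₁₂ = −X_u − X_u` vs ★ `K2LiuFinChirpLocalGramReading`'s `−(2 • X_u)`). [folklore] -/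
theorem neg_sub_self_eq_neg_two_smul {α : Type*} [AddCommGroup α] (X : α) : -X - X = -(2 • X) := by
  rw [two_nsmul, neg_add']

/-- `reindex 0 = 0`. [folklore] -/
theorem reindex_zero_eq {α : Type*} [Zero α] {ι κ ι' κ' : Type*} (eι : ι ≃ ι') (eκ : κ ≃ κ') :
    Matrix.reindex eι eκ (0 : Matrix ι κ α) = 0 := Matrix.ext fun _ _ => rfl

/-- a multiplicative map transforms scalars entrywise: `(r • M) ⊗ f = f r • (M ⊗ f)` (rectangular form of Mathlib `Matrix.map_smul'`). [folklore] -/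
theorem map_smul_ringHom {A B : Type*} [NonAssocSemiring A] [NonAssocSemiring B] {ι κ : Type*} (f : A →+* B) (r : A) (M : Matrix ι κ A) :
    (r • M).map f = f r • M.map f := Matrix.ext fun _ _ => map_mul f _ _

end Coordinates

/-! ## §2 The rider: `(c_q).map arch = 0` for a finite-adelic unipotent `u` -/

section Rider

variable (L : Type) [Field L] [NumberField L] [IsCMField L]
variable {N M n : ℕ} (e : Fin N × Fin M ≃ Fin n)
  (dV : Fin N → L) (hdV : ∀ i, IsCMField.complexConj L (dV i) = dV i) (hdV0 : ∀ i, dV i ≠ 0)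
  (dW : Fin M → L) (hdW : ∀ i, IsCMField.complexConj L (dW i) = dW i) (hdW0 : ∀ i, dW i ≠ 0)
variable {n'' : ℕ} (e₁ : Fin (n + n) × Fin 1 ≃ Fin n'') (a' : (↥(maximalRealSubfield L))ˣ)

include hdV0 hdW0 in
/-- **THE ARCH-ZERO RIDER**: for `u ∈ N_Δ(𝔸)` whose block coordinate `X_u = (blk u)₁₂` has ZERO ARCHIMEDEAN PART (`X_u.map adeleFst = 0`, ★ `K2LiuUnipotentChartLocal`'s `hfst`),
the unipotent part `c_q` of `q_u = ratSp κ′ · j(u) · (ratSp κ′)⁻¹` has zero archimedean part: `(SiegelParabolicPi.cMat q_u).map (archHom L⁺) = 0` (★ FILE 2c's explicit `c_q`;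
every block of `Res(−X_u − X_u)` carries `re` or `im` of `−X_u − X_u`, §1). [cite: Kudla1994, §3] [cite: Weil1964, Chap. III n° 46 p. 202] -/
theorem cMat_lineKappa_map_archHom_eq_zero_of_mem_unipDelta
    (hT₁ : IsUnit (adelicGram (Fp L) e₁ (realDiagonal L (dD L e dV hdV dW hdW) (dD_conj L e dV hdV dW hdW)) (TW (Fp L) a')).det)
    (JW : Matrix (Fin 1) (Fin 1) L) (hV : (realDiagonal L (dD L e dV hdV dW hdW) (dD_conj L e dV hdV dW hdW)).IsSymm) (hW : (TW (Fp L) a').IsSymm)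
    (hJV : Matrix.diagonal (dD L e dV hdV dW hdW) = (realDiagonal L (dD L e dV hdV dW hdW) (dD_conj L e dV hdV dW hdW)).map (algebraMap (Fp L) L))
    (hJW : JW = (TW (Fp L) a').map (algebraMap (Fp L) L)) {u : HA L e dV hdV dW hdW} (hu : u ∈ unipDelta L e dV hdV dW hdW)
    (hX : ((blk L e dV hdV dW hdW u).toBlocks₁₂).map (UnitaryGroup.adeleFst L) = 0) :
    (SiegelParabolicPi.cMat (ratSp (Fp L) (adelicGram (Fp L) e₁ (realDiagonal L (dD L e dV hdV dW hdW) (dD_conj L e dV hdV dW hdW)) (TW (Fp L) a')) hT₁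
          (⟨_, lineCayleyMover_mem_symplecticGroup (Fp L) n ((Equiv.prodUnique (Fin (n + n)) (Fin 1)).symm.trans e₁) (Units.mul_inv a')⟩ : Matrix.symplecticGroup (Fin n'') (Fp L)) *
        (toSp (Fp L) L (IsCMField.complexConj L) (n + n) 1 e₁ (Matrix.diagonal (dD L e dV hdV dW hdW)) JW
            (complexConj_imagUnit L) (imagUnit_ne_zero L) (imagUnit_mul_self L) hV hW hJV hJW
            (UnitaryGroup.adelicInl (Fp L) L (IsCMField.complexConj L) (n + n) 1 (Matrix.diagonal (dD L e dV hdV dW hdW)) JW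
              (toDiagA L e dV hdV dW hdW u))) *
        (ratSp (Fp L) (adelicGram (Fp L) e₁ (realDiagonal L (dD L e dV hdV dW hdW) (dD_conj L e dV hdV dW hdW)) (TW (Fp L) a')) hT₁
          (⟨_, lineCayleyMover_mem_symplecticGroup (Fp L) n ((Equiv.prodUnique (Fin (n + n)) (Fin 1)).symm.trans e₁) (Units.mul_inv a')⟩ : Matrix.symplecticGroup (Fin n'') (Fp L)))⁻¹)).map (archHom (Fp L)) = 0 := by
  have hY : (-(blk L e dV hdV dW hdW u).toBlocks₁₂ - (blk L e dV hdV dW hdW u).toBlocks₁₂).map (UnitaryGroup.adeleFst L) = 0 := by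
    rw [Matrix.map_sub _ (map_sub _), Matrix.map_neg _ (map_neg _), hX, neg_zero, sub_zero]
  have hre := map_re_map_archHom_eq_zero L _ hY
  have him := map_im_map_archHom_eq_zero L _ hY
  rw [(aMat_cMat_lineKappa_of_mem_unipDelta L e dV hdV hdV0 dW hdW hdW0 e₁ a' hT₁ JW hV hW hJV hJW hu).2]
  simp only [Matrix.map_mul, reindex_map_eq, map_smul_ringHom, Matrix.fromBlocks_map, hre, him, Matrix.zero_mul, Matrix.mul_zero, smul_zero,
    Matrix.fromBlocks_zero, reindex_zero_eq]

include hdV0 hdW0 in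
/-- **THE LETTER `hS0` OF ★ FILE 3** at `S := (−⅟2) • c_q` (so `hS := rfl`): `((−⅟2) • SiegelParabolicPi.cMat q_u).map (archHom L⁺) = 0` for a finite-adelic unipotent `u`.
[cite: Kudla1994, §3] [cite: Weil1964, Chap. I n° 13 p. 160] -/
theorem hS0_lineKappa_of_mem_unipDelta
    (hT₁ : IsUnit (adelicGram (Fp L) e₁ (realDiagonal L (dD L e dV hdV dW hdW) (dD_conj L e dV hdV dW hdW)) (TW (Fp L) a')).det)
    (JW : Matrix (Fin 1) (Fin 1) L) (hV : (realDiagonal L (dD L e dV hdV dW hdW) (dD_conj L e dV hdV dW hdW)).IsSymm) (hW : (TW (Fp L) a').IsSymm)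
    (hJV : Matrix.diagonal (dD L e dV hdV dW hdW) = (realDiagonal L (dD L e dV hdV dW hdW) (dD_conj L e dV hdV dW hdW)).map (algebraMap (Fp L) L))
    (hJW : JW = (TW (Fp L) a').map (algebraMap (Fp L) L)) {u : HA L e dV hdV dW hdW} (hu : u ∈ unipDelta L e dV hdV dW hdW)
    (hX : ((blk L e dV hdV dW hdW u).toBlocks₁₂).map (UnitaryGroup.adeleFst L) = 0) :
    ((-⅟(2 : (AdeleRing (𝓞 (Fp L)) (Fp L)))) • SiegelParabolicPi.cMat (ratSp (Fp L) (adelicGram (Fp L) e₁ (realDiagonal L (dD L e dV hdV dW hdW) (dD_conj L e dV hdV dW hdW)) (TW (Fp L) a')) hT₁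
          (⟨_, lineCayleyMover_mem_symplecticGroup (Fp L) n ((Equiv.prodUnique (Fin (n + n)) (Fin 1)).symm.trans e₁) (Units.mul_inv a')⟩ : Matrix.symplecticGroup (Fin n'') (Fp L)) *
        (toSp (Fp L) L (IsCMField.complexConj L) (n + n) 1 e₁ (Matrix.diagonal (dD L e dV hdV dW hdW)) JW
            (complexConj_imagUnit L) (imagUnit_ne_zero L) (imagUnit_mul_self L) hV hW hJV hJW
            (UnitaryGroup.adelicInl (Fp L) L (IsCMField.complexConj L) (n + n) 1 (Matrix.diagonal (dD L e dV hdV dW hdW)) JW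
              (toDiagA L e dV hdV dW hdW u))) *
        (ratSp (Fp L) (adelicGram (Fp L) e₁ (realDiagonal L (dD L e dV hdV dW hdW) (dD_conj L e dV hdV dW hdW)) (TW (Fp L) a')) hT₁
          (⟨_, lineCayleyMover_mem_symplecticGroup (Fp L) n ((Equiv.prodUnique (Fin (n + n)) (Fin 1)).symm.trans e₁) (Units.mul_inv a')⟩ : Matrix.symplecticGroup (Fin n'') (Fp L)))⁻¹)).map (archHom (Fp L)) = 0 := by
  rw [map_smul_ringHom, cMat_lineKappa_map_archHom_eq_zero_of_mem_unipDelta L e dV hdV hdV0 dW hdW hdW0 e₁ a' hT₁ JW hV hW hJV hJW hu hX,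
    smul_zero]

end Rider

end Summit.HodgeConjecture.HodgeConjecture.Cruxes.HLiu418.K2LiuLinePairCayleySiegelArchZero

end
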